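import Summits.ResolutionOfSingularities.ResolutionOfSingularities.Theorems.WeightedInvariantLocalWeightedDropTrackCNCInduction
import Summits.ResolutionOfSingularities.ResolutionOfSingularities.Theorems.WeightedInvariantLocalWeightedDropSpaceCountGame

/-!
# The line `tame-four-tuple-drop`: (A3) — the radical non-normal-crossing count for surface germs, modulo F-32bR

[OURS · L1 W4.3 · chain w43, engine crux `LocalWeightedDrop` stmt-ResolutionOfSingularities-8899; strategist res-L1-w43-strat-1's
line `tame-four-tuple-drop` (`L/res-L1-w43-strat-1/tame_four_tuple_drop_v1.lean` 9c94f6e133b67480), stub (A3)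
`stub_spaceNonNCCountRad_of_CJS`, cut per strat-1's RULING 05:42:56Z: (A3-α) game layer res-type-056 (`…SpaceCountDefs/Game/
GameInvariance`), (A3-β) transfer res-type-088 (`…TrackCNCPayload/NCStep/NCInduction`); this file composes them]
NOT a statement of any manuscript; the games are the programme's own.

* `TameFourTupleDrop.germIsNC_of_dvd_pow` — (N1) radical heredity of normal-crossing support: `d` NC, `b ∣ d^(N+1)` ⇒ `b` NC
  (`TrackC.exists_unit_mul_monomial_of_dvd_pow`, same coordinates).
* `TameFourTupleDrop.exists_winsIn_germIsNC_of_CJSB` — (A3-β) by name: F-32bR ⇒ every non-zero germ of `k⟦x₀,x₁,x₂⟧` is won in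
  finitely many rounds of the count game for `GermIsNC` (`TrackC.exists_level_of_CJSB` at `W n := WinsIn GermIsNC n`).
* `TameFourTupleDrop.stub_spaceNonNCCountRad_of_CJS` — **(A3) VERBATIM**:
  `CossartJannsenSaito2020EmbeddedSequenceB.{0} → ∀ k [Field k], SpaceGermNonNCCountRad k`.
* (G3) `stub_tupleDropSpace` closes VERBATIM by `tupleDropThree_of_count_of_monomialPhase SpaceIsNC ν h₁ h₂ h₃ hmono` (p501911)
  once the (B3) owner lands the `SpaceMonomialPhase` definition (not yet a tree constant).
With (B3) `stub_spaceMonomialPhase` (res-L1-w43-stub-8) the line's kernel-checked `tameWideApexFourStartsWon_of_pieces` then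
banks the N = 4 TAME residual of the engine modulo ⟨F-32bR⟩.
-/

noncomputable section

open Literature.AlgebraicGeometry.Resolution

set_option linter.dupNamespace false -- mandated namespace of this single-conjunct summit

namespace Summit.ResolutionOfSingularities.ResolutionOfSingularities.Theorems.TameFourTupleDrop

variable {k : Type} [Field k]

/-- **(N1) Radical heredity of normal-crossing support**: if `d ≠ 0` is a normal crossing (`GermIsNC d`) and `b ∣ d^(N+1)`, then
`b` is a normal crossing, in the same coordinates. [OURS · L1 W4.3] -/
theorem germIsNC_of_dvd_pow {n : ℕ} (N : ℕ) (b d : MvPowerSeries (Fin n) k) (_hd : d ≠ 0) (hnc : GermIsNC d)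
    (hdvd : b ∣ d ^ (N + 1)) : GermIsNC b := by
  obtain ⟨Φ, u, e, hΦ0, hdet, hu, hde⟩ := hnc
  obtain ⟨v, e', hv, hbe⟩ := TrackC.exists_unit_mul_monomial_of_dvd_pow Φ hΦ0 u hu e hde N hdvd
  exact ⟨Φ, v, e', hΦ0, hdet, hv, hbe⟩

/-- **(A3-β) by name.** The corrected Cossart–Jannsen–Saito sequence fact F-32bR implies that every non-zero germ
`b ∈ k⟦x₀,x₁,x₂⟧` is won in finitely many rounds of the count game with terminal predicate `GermIsNC`
(`TrackC.exists_level_of_CJSB` with the graded payload `W n := WinsIn GermIsNC n`). [OURS · L1 W4.3] -/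
theorem exists_winsIn_germIsNC_of_CJSB (hCJS : CossartJannsenSaito2020EmbeddedSequenceB.{0})
    (b : MvPowerSeries (Fin 3) k) (hb : b ≠ 0) : ∃ n, WinsIn (m := 2) GermIsNC n b := by
  refine TrackC.exists_level_of_CJSB (k := k) hCJS (fun n => WinsIn (m := 2) GermIsNC n) ?_ ?_ ?_ b hb
  · intro g Φ v e hΦ0 hdet hv hge
    exact (winsIn_zero _ _).mpr ⟨Φ, v, e, hΦ0, hdet, hv, hge⟩
  · intro n g hg
    exact WinsIn.mono (Nat.le_succ n) hg
  · intro n g Φ w hΦ0 hdet hw1 hwpos hclause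
    exact winsIn_move ⟨hΦ0, hdet, hw1, hwpos⟩ hclause

/-- **(A3) OF THE LINE `tame-four-tuple-drop`, VERBATIM** — the radical non-normal-crossing count for surface germs in
3-space with free smooth centres, from the corrected Cossart–Jannsen–Saito sequence fact ⟨F-32bR⟩: (A3-β) transfer
(`exists_winsIn_germIsNC_of_CJSB`) ∘ (A3-α) game layer (`spaceGermNonNCCountRad_of_winsIn`, res-type-056) with the heredity
(N1) `germIsNC_of_dvd_pow`. [OURS · L1 W4.3] -/
theorem stub_spaceNonNCCountRad_of_CJS (hCJS : CossartJannsenSaito2020EmbeddedSequenceB.{0}) :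
    ∀ (k : Type) [Field k], SpaceGermNonNCCountRad k := by
  intro k _
  exact spaceGermNonNCCountRad_of_winsIn (fun N b d hd hnc hdvd => germIsNC_of_dvd_pow N b d hd hnc hdvd)
    (fun b hb => exists_winsIn_germIsNC_of_CJSB hCJS b hb)

end Summit.ResolutionOfSingularities.ResolutionOfSingularities.Theorems.TameFourTupleDrop

end
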